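import Mathlib.MeasureTheory.Integral.IntervalIntegral.Periodic
import Mathlib.MeasureTheory.Measure.Lebesgue.Basic
import Mathlib.Analysis.SpecialFunctions.Trigonometric.Bounds
import Summits.HubbardSuperconductivity.HubbardSuperconductivity.Theorems.ThermalWedgeTwSeededEnsembleEquivalenceRFreeColdEdgeReduction

/-!
# Crux `TwSeededEnsembleEquivalenceR` (stmt-HubbardSuperconductivity-15581), line `cold-floor-collapse`
# (slug `Sketch`) — F3 `stub_freeDensityNearHalfFilling`: the free BdG density just below half filling

Support file (`--supports stmt-HubbardSuperconductivity-15581`; sorry-free; no definition). Registered stub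
`stub_freeDensityNearHalfFilling`: for `β ≥ 20000`, EVERY pairing source `h ∈ ℝ` and
`μ ∈ [−1/50000, −1/100000]`, the Brillouin-zone average
`N(β,μ,h) = (1/4π²)∫₀^{2π}∫₀^{2π} [1 − φ(ξ, D)] dθ₂ dθ₁` of the free (`U = 0`) `d`-wave BdG density,
`φ(z, D) = (z/√(z²+D)) tanh(β√(z²+D)/2)`, `ξ = −2(cos θ₁ + cos θ₂) − μ`, `D = 8h²(cos θ₁ − cos θ₂)²`,
is `≥ 19/20` (only `β > 0` is actually used).

* (A) `(π,π)`-shift: `θᵢ ↦ θᵢ + π` flips `ε = −2(cos θ₁ + cos θ₂)` and fixes `D`; an iterated integral over a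
  period square is shift invariant (`Function.Periodic.intervalIntegral_add_eq`) and `φ` is odd in `z`, so
  `2 ∫∫ (1 − φ(ε − μ)) = ∫∫ (2 − Γ)`, `Γ := φ(ε − μ, D) − φ(ε + μ, D)` (`m := −μ ∈ [10⁻⁵, 2·10⁻⁵]`).
* (B) Pointwise `Γ ≤ 2` (`|φ| ≤ 1`), and `Γ ≤ 2m/(τ − m)` where `|ε| ≥ τ := 1/500`: by the kernel form
  `φ(z, D) = z (β/2) T(β√(z²+D)/2)`, `T(y) = ∫₀¹ sech²(ty) dt = tanh y / y` (`cfl_bdgPhi_eq_kernel`), `T`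
  nonincreasing on `[0,∞)`, one gets `φ(z₂) − φ(z₁) ≤ (z₂ − z₁)(β/2)T(βE₁/2) ≤ (z₂ − z₁)/z₁` for `0 < z₁ ≤ z₂`.
* (C) Level-set lemma `∫₀^{2π} 1{|cos θ − α| < τ'} dθ ≤ 2π√τ'`: on `[0, π]` two points of the window are within
  `π√τ'` (`cos x − cos y = 2 sin((x+y)/2) sin((y−x)/2) ≥ 2(y−x)²/π²`, Jordan's inequality), so
  `Real.volume_le_diam` bounds its measure; `[π, 2π]` by the reflection `θ ↦ 2π − θ`.
* (D) Integrate (`|ε| < τ ⇔ |cos θ₂ + cos θ₁| < τ/2`): `N ≥ 1 − √(τ/2) − m/(τ − m) ≥ 1 − 0.0317 − 1/99 > 19/20`.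

[folklore: BdG mean-field density of states near half filling; particle–hole symmetry of the square-lattice
band under the `(π,π)` momentum shift]
-/

set_option linter.dupNamespace false

namespace Summit.HubbardSuperconductivity.HubbardSuperconductivity.Theorems.TwSeededEnsembleEquivalenceR.ColdFloorLine

open Real MeasureTheory intervalIntegral

/-! ### (C) The cosine level-set lemma -/

/-- For `0 ≤ x ≤ y ≤ π`: `2(y − x)²/π² ≤ cos x − cos y` (product formula and Jordan's inequality). [folklore] -/
theorem fdh_sq_le_cos_sub_cos {x y : ℝ} (hx : 0 ≤ x) (hxy : x ≤ y) (hy : y ≤ π) :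
    2 * (y - x) ^ 2 / π ^ 2 ≤ Real.cos x - Real.cos y := by
  have hπ := Real.pi_pos
  rw [Real.cos_sub_cos, show (x - y) / 2 = -((y - x) / 2) by ring, Real.sin_neg]
  have hp : 2 / π * ((y - x) / 2) ≤ Real.sin ((y - x) / 2) := Real.mul_le_sin (by linarith) (by linarith)
  have hp0 : 0 ≤ Real.sin ((y - x) / 2) := le_trans (mul_nonneg (by positivity) (by linarith)) hp
  have hq : Real.sin ((y - x) / 2) ≤ Real.sin ((x + y) / 2) := by
    rcases le_or_gt ((x + y) / 2) (π / 2) with h | h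
    · exact Real.sin_le_sin_of_le_of_le_pi_div_two (by linarith) h (by linarith)
    · rw [← Real.sin_pi_sub ((x + y) / 2)]
      exact Real.sin_le_sin_of_le_of_le_pi_div_two (by linarith) (by linarith) (by linarith)
  have h3 : y - x ≤ Real.sin ((y - x) / 2) * π := by
    rw [show 2 / π * ((y - x) / 2) = (y - x) / π by ring, div_le_iff₀ hπ] at hp
    exact hp
  have h4 : (y - x) ^ 2 ≤ (Real.sin ((y - x) / 2) * π) ^ 2 := pow_le_pow_left₀ (by linarith) h3 2
  have h5 : Real.sin ((y - x) / 2) * Real.sin ((y - x) / 2) * π ^ 2 ≤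
      Real.sin ((x + y) / 2) * Real.sin ((y - x) / 2) * π ^ 2 :=
    mul_le_mul_of_nonneg_right (mul_le_mul_of_nonneg_right hq hp0) (sq_nonneg π)
  rw [div_le_iff₀ (by positivity)]
  nlinarith [h4, h5]

/-- Two points of `[0, π]` whose cosines lie in a common open window of half-width `τ'` are within `π√τ'`.
[folklore] -/
theorem fdh_levelset_dist_le {α τ' x y : ℝ} (hτ : 0 < τ') (hx : x ∈ Set.Icc 0 π) (hy : y ∈ Set.Icc 0 π)
    (hxα : |Real.cos x - α| < τ') (hyα : |Real.cos y - α| < τ') : dist x y ≤ π * Real.sqrt τ' := by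
  wlog hxy : x ≤ y generalizing x y
  · rw [dist_comm]; exact this hy hx hyα hxα (not_le.mp hxy).le
  rw [Real.dist_eq, abs_sub_comm, abs_of_nonneg (sub_nonneg.2 hxy)]
  have h1 := fdh_sq_le_cos_sub_cos hx.1 hxy hy.2
  rw [div_le_iff₀ (by positivity)] at h1
  rw [abs_lt] at hxα hyα
  have h2 : (Real.cos x - Real.cos y) * π ^ 2 < 2 * τ' * π ^ 2 :=
    mul_lt_mul_of_pos_right (by linarith [hxα.2, hyα.1]) (by positivity)
  have h3 : (y - x) ^ 2 < (π * Real.sqrt τ') ^ 2 := by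
    rw [mul_pow, Real.sq_sqrt hτ.le]; linarith
  exact (le_abs_self _).trans (abs_lt_of_sq_lt_sq h3 (by positivity)).le

/-- The cosine level window `{θ | |cos θ − α| < τ'}` is measurable. [folklore] -/
theorem fdh_measurableSet_levelset (α τ' : ℝ) : MeasurableSet {θ : ℝ | |Real.cos θ - α| < τ'} :=
  measurableSet_lt (by fun_prop : Continuous fun θ : ℝ => |Real.cos θ - α|).measurable measurable_const

/-- On `[0, π]` and on `[π, 2π]` the cosine level window has Lebesgue measure `≤ π√τ'` (two of its points are
within `π√τ'`, `Real.volume_le_diam`; the second half by the reflection `θ ↦ 2π − θ`). [folklore] -/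
theorem fdh_volume_levelset_le (α : ℝ) {τ' : ℝ} (hτ : 0 < τ') :
    volume ({θ : ℝ | |Real.cos θ - α| < τ'} ∩ Set.Icc 0 π) ≤ ENNReal.ofReal (π * Real.sqrt τ') ∧
      volume ({θ : ℝ | |Real.cos θ - α| < τ'} ∩ Set.Icc π (2 * π)) ≤ ENNReal.ofReal (π * Real.sqrt τ') := by
  constructor
  · refine (Real.volume_le_diam _).trans (Metric.ediam_le fun x hx y hy => ?_)
    rw [edist_dist]
    exact ENNReal.ofReal_le_ofReal (fdh_levelset_dist_le hτ hx.2 hy.2 hx.1 hy.1)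
  · refine (Real.volume_le_diam _).trans (Metric.ediam_le fun x hx y hy => ?_)
    rw [edist_dist]
    refine ENNReal.ofReal_le_ofReal ?_
    have h := fdh_levelset_dist_le (x := 2 * π - x) (y := 2 * π - y) (α := α) hτ
      ⟨by linarith [hx.2.2], by linarith [hx.2.1]⟩ ⟨by linarith [hy.2.2], by linarith [hy.2.1]⟩
      (by rw [Real.cos_two_pi_sub]; exact hx.1) (by rw [Real.cos_two_pi_sub]; exact hy.1)
    rw [Real.dist_eq, show 2 * π - x - (2 * π - y) = -(x - y) by ring, abs_neg] at h
    rwa [Real.dist_eq]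

/-- **Level-set lemma**: `∫₀^{2π} 1{|cos θ − α| < τ'} dθ ≤ 2π√τ'`. [folklore] -/
theorem fdh_integral_levelset_le (α : ℝ) {τ' : ℝ} (hτ : 0 < τ') :
    ∫ θ in (0 : ℝ)..2 * π, (if |Real.cos θ - α| < τ' then (1 : ℝ) else 0) ≤ 2 * π * Real.sqrt τ' := by
  have hS := fdh_measurableSet_levelset α τ'
  have hfun : (fun θ : ℝ => if |Real.cos θ - α| < τ' then (1 : ℝ) else 0) =
      fun θ : ℝ => {θ : ℝ | |Real.cos θ - α| < τ'}.indicator (fun _ => (1 : ℝ)) θ := by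
    funext θ
    by_cases hθ : |Real.cos θ - α| < τ'
    · rw [if_pos hθ, Set.indicator_of_mem (by exact hθ)]
    · rw [if_neg hθ, Set.indicator_of_notMem (by exact hθ)]
  rw [intervalIntegral.integral_of_le (by positivity), hfun, MeasureTheory.integral_indicator_const _ hS,
    measureReal_restrict_apply hS, smul_eq_mul, mul_one, measureReal_def]
  refine ENNReal.toReal_le_of_le_ofReal (by positivity) ?_
  obtain ⟨h1, h2⟩ := fdh_volume_levelset_le α hτ
  have hsub : {θ : ℝ | |Real.cos θ - α| < τ'} ∩ Set.Ioc 0 (2 * π) ⊆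
      ({θ : ℝ | |Real.cos θ - α| < τ'} ∩ Set.Icc 0 π) ∪ ({θ : ℝ | |Real.cos θ - α| < τ'} ∩ Set.Icc π (2 * π)) := by
    rintro θ ⟨hθ, h0, h2π⟩
    rcases le_total θ π with h | h
    · exact Or.inl ⟨hθ, h0.le, h⟩
    · exact Or.inr ⟨hθ, h, h2π⟩
  calc volume ({θ : ℝ | |Real.cos θ - α| < τ'} ∩ Set.Ioc 0 (2 * π))
      ≤ volume (({θ : ℝ | |Real.cos θ - α| < τ'} ∩ Set.Icc 0 π) ∪
          ({θ : ℝ | |Real.cos θ - α| < τ'} ∩ Set.Icc π (2 * π))) := measure_mono hsub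
    _ ≤ volume ({θ : ℝ | |Real.cos θ - α| < τ'} ∩ Set.Icc 0 π) +
          volume ({θ : ℝ | |Real.cos θ - α| < τ'} ∩ Set.Icc π (2 * π)) := measure_union_le _ _
    _ ≤ ENNReal.ofReal (π * Real.sqrt τ') + ENNReal.ofReal (π * Real.sqrt τ') := add_le_add h1 h2
    _ = ENNReal.ofReal (2 * π * Real.sqrt τ') := by
        rw [← ENNReal.ofReal_add (by positivity) (by positivity)]; congr 1; ring

/-- The indicator of the cosine level window is interval integrable. [folklore] -/
theorem fdh_intervalIntegrable_levelset (α τ' a b : ℝ) :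
    IntervalIntegrable (fun θ : ℝ => if |Real.cos θ - α| < τ' then (1 : ℝ) else 0) volume a b := by
  refine (intervalIntegrable_const (c := (1 : ℝ))).mono_fun' ?_ (Filter.Eventually.of_forall fun θ => ?_)
  · exact (Measurable.ite (fdh_measurableSet_levelset α τ') measurable_const measurable_const).aestronglyMeasurable
  · show ‖(if |Real.cos θ - α| < τ' then (1 : ℝ) else 0)‖ ≤ 1
    split_ifs <;> simp

/-! ### (A) Shift invariance of period integrals -/

/-- A `2π`-periodic function has the same integral over `[0, 2π]` after the shift `θ ↦ θ + π`. [folklore] -/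
theorem fdh_integral_shift_pi (g : ℝ → ℝ) (hg : Function.Periodic g (2 * π)) :
    ∫ x in (0 : ℝ)..2 * π, g (x + π) = ∫ x in (0 : ℝ)..2 * π, g x := by
  rw [intervalIntegral.integral_comp_add_right g π, zero_add, show 2 * π + π = π + 2 * π by ring]
  have h := hg.intervalIntegral_add_eq π 0
  rwa [zero_add] at h

/-- The iterated integral over `[0, 2π]²` of a function `2π`-periodic in each variable is invariant under the
shift `(θ₁, θ₂) ↦ (θ₁ + π, θ₂ + π)`. [folklore] -/
theorem fdh_double_integral_shift_pi (f : ℝ → ℝ → ℝ) (h1 : ∀ x y, f (x + 2 * π) y = f x y)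
    (h2 : ∀ x y, f x (y + 2 * π) = f x y) :
    ∫ x in (0 : ℝ)..2 * π, ∫ y in (0 : ℝ)..2 * π, f (x + π) (y + π) =
      ∫ x in (0 : ℝ)..2 * π, ∫ y in (0 : ℝ)..2 * π, f x y := by
  have inner : ∀ x, ∫ y in (0 : ℝ)..2 * π, f x (y + π) = ∫ y in (0 : ℝ)..2 * π, f x y :=
    fun x => fdh_integral_shift_pi (f x) fun y => h2 x y
  simp only [inner]
  exact fdh_integral_shift_pi (fun x => ∫ y in (0 : ℝ)..2 * π, f x y) fun x => by simp only [h1]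

/-! ### (B) Facts on the BdG function `φ_d(z) = (z/√(z²+d)) tanh(β√(z²+d)/2)` -/

/-- `φ_d` is odd in `z`. [folklore] -/
theorem fdh_bdgPhi_neg (β z d : ℝ) :
    (if (-z) ^ 2 + d = 0 then (0:ℝ) else -z / Real.sqrt ((-z) ^ 2 + d) * Real.tanh (β * Real.sqrt ((-z) ^ 2 + d) / 2)) =
      -(if z ^ 2 + d = 0 then (0:ℝ) else z / Real.sqrt (z ^ 2 + d) * Real.tanh (β * Real.sqrt (z ^ 2 + d) / 2)) := by
  simp only [neg_sq]
  split_ifs <;> ring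

/-- `φ_d ≤ 1` (`d ≥ 0`): `|z| ≤ √(z²+d)` and `|tanh| ≤ 1`. [folklore] -/
theorem fdh_bdgPhi_le_one (β : ℝ) {z d : ℝ} (hd : 0 ≤ d) :
    (if z ^ 2 + d = 0 then (0:ℝ) else z / Real.sqrt (z ^ 2 + d) * Real.tanh (β * Real.sqrt (z ^ 2 + d) / 2)) ≤ 1 := by
  split_ifs with h0
  · exact zero_le_one
  · have hE : 0 < Real.sqrt (z ^ 2 + d) := Real.sqrt_pos.2 (lt_of_le_of_ne (by positivity) (Ne.symm h0))
    have h1 : |z / Real.sqrt (z ^ 2 + d)| ≤ 1 := by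
      rw [abs_div, abs_of_pos hE, div_le_one hE]
      exact Real.abs_le_sqrt (by linarith)
    calc z / Real.sqrt (z ^ 2 + d) * Real.tanh (β * Real.sqrt (z ^ 2 + d) / 2)
        ≤ |z / Real.sqrt (z ^ 2 + d) * Real.tanh (β * Real.sqrt (z ^ 2 + d) / 2)| := le_abs_self _
      _ = |z / Real.sqrt (z ^ 2 + d)| * |Real.tanh (β * Real.sqrt (z ^ 2 + d) / 2)| := abs_mul _ _
      _ ≤ 1 * 1 := mul_le_mul h1 (Real.abs_tanh_lt_one _).le (abs_nonneg _) zero_le_one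
      _ = 1 := one_mul 1

/-- The `tanh` kernel `T(y) = ∫₀¹ sech²(ty) dt` is nonincreasing on `[0, ∞)` (`cosh` is nondecreasing there).
[folklore] -/
theorem fdh_tanhKernel_antitone {y y' : ℝ} (hy : 0 ≤ y) (hyy' : y ≤ y') :
    ∫ t in (0:ℝ)..1, 1 / Real.cosh (t * y') ^ 2 ≤ ∫ t in (0:ℝ)..1, 1 / Real.cosh (t * y) ^ 2 := by
  refine intervalIntegral.integral_mono_on zero_le_one ?_ ?_ fun t ht => ?_
  · exact (continuous_const.div (by fun_prop) fun t => (pow_pos (Real.cosh_pos _) 2).ne').intervalIntegrable _ _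
  · exact (continuous_const.div (by fun_prop) fun t => (pow_pos (Real.cosh_pos _) 2).ne').intervalIntegrable _ _
  · apply one_div_le_one_div_of_le (pow_pos (Real.cosh_pos _) 2)
    apply pow_le_pow_left₀ (Real.cosh_pos _).le
    rw [Real.cosh_le_cosh, abs_of_nonneg (mul_nonneg ht.1 hy), abs_of_nonneg (mul_nonneg ht.1 (hy.trans hyy'))]
    exact mul_le_mul_of_nonneg_left hyy' ht.1

/-- **One-sided Lipschitz bound**: for `β > 0`, `d ≥ 0`, `0 < z₁ ≤ z₂`, `φ_d(z₂) − φ_d(z₁) ≤ (z₂ − z₁)/z₁`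
(kernel form `φ_d(z) = z (β/2) T(βE/2)`, `T` nonincreasing, `(β/2) T(βE₁/2) = tanh(βE₁/2)/E₁ ≤ 1/z₁`).
[folklore] -/
theorem fdh_bdgPhi_sub_le {β : ℝ} (hβ : 0 < β) {z₁ z₂ d : ℝ} (hd : 0 ≤ d) (hz₁ : 0 < z₁) (hz : z₁ ≤ z₂) :
    (if z₂ ^ 2 + d = 0 then (0:ℝ) else z₂ / Real.sqrt (z₂ ^ 2 + d) * Real.tanh (β * Real.sqrt (z₂ ^ 2 + d) / 2)) -
      (if z₁ ^ 2 + d = 0 then (0:ℝ) else z₁ / Real.sqrt (z₁ ^ 2 + d) * Real.tanh (β * Real.sqrt (z₁ ^ 2 + d) / 2)) ≤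
      (z₂ - z₁) / z₁ := by
  rw [cfl_bdgPhi_eq_kernel hβ hd z₂, cfl_bdgPhi_eq_kernel hβ hd z₁]
  have hS₁ : z₁ ≤ Real.sqrt (z₁ ^ 2 + d) := (Real.le_sqrt' hz₁).2 (by linarith)
  have hS : Real.sqrt (z₁ ^ 2 + d) ≤ Real.sqrt (z₂ ^ 2 + d) :=
    Real.sqrt_le_sqrt (by linarith [pow_le_pow_left₀ hz₁.le hz 2])
  have hkey : β * Real.sqrt (z₁ ^ 2 + d) / 2 *
      (∫ t in (0:ℝ)..1, 1 / Real.cosh (t * (β * Real.sqrt (z₁ ^ 2 + d) / 2)) ^ 2) ≤ 1 := by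
    rw [cfl_mul_tanhKernel]; exact (Real.tanh_lt_one _).le
  have hT := fdh_tanhKernel_antitone (y := β * Real.sqrt (z₁ ^ 2 + d) / 2) (y' := β * Real.sqrt (z₂ ^ 2 + d) / 2)
    (by positivity) (by linarith [mul_le_mul_of_nonneg_left hS hβ.le])
  have hT₁0 : 0 ≤ ∫ t in (0:ℝ)..1, 1 / Real.cosh (t * (β * Real.sqrt (z₁ ^ 2 + d) / 2)) ^ 2 :=
    intervalIntegral.integral_nonneg zero_le_one fun t _ => by positivity
  set T₁ := ∫ t in (0:ℝ)..1, 1 / Real.cosh (t * (β * Real.sqrt (z₁ ^ 2 + d) / 2)) ^ 2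
  set T₂ := ∫ t in (0:ℝ)..1, 1 / Real.cosh (t * (β * Real.sqrt (z₂ ^ 2 + d) / 2)) ^ 2
  have hw : β / 2 * T₁ * z₁ ≤ 1 :=
    calc β / 2 * T₁ * z₁ ≤ β / 2 * T₁ * Real.sqrt (z₁ ^ 2 + d) :=
          mul_le_mul_of_nonneg_left hS₁ (mul_nonneg (by positivity) hT₁0)
      _ = β * Real.sqrt (z₁ ^ 2 + d) / 2 * T₁ := by ring
      _ ≤ 1 := hkey
  have h1 : z₂ * (β / 2) * T₂ ≤ z₂ * (β / 2) * T₁ :=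
    mul_le_mul_of_nonneg_left hT (mul_nonneg (by linarith) (by positivity))
  rw [le_div_iff₀ hz₁]
  calc (z₂ * (β / 2) * T₂ - z₁ * (β / 2) * T₁) * z₁ ≤ (z₂ * (β / 2) * T₁ - z₁ * (β / 2) * T₁) * z₁ :=
        mul_le_mul_of_nonneg_right (sub_le_sub_right h1 _) hz₁.le
    _ = (z₂ - z₁) * (β / 2 * T₁ * z₁) := by ring
    _ ≤ (z₂ - z₁) * 1 := mul_le_mul_of_nonneg_left hw (sub_nonneg.2 hz)
    _ = z₂ - z₁ := mul_one _

/-- **Pointwise bound on `Γ = P(e − μ) − P(e + μ)`** for an odd, `≤ 1`, one-sided Lipschitz `P` (`μ ≤ 0`,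
`−μ < τ`): `Γ ≤ 2χ + 2(−μ)/(τ + μ)` whenever `χ ≥ 0` and `χ ≥ 1` on `{|e| < τ}`. [folklore] -/
theorem fdh_gamma_le {P : ℝ → ℝ → ℝ} (hodd : ∀ z d, P (-z) d = -P z d) (hle : ∀ z d, 0 ≤ d → P z d ≤ 1)
    (hlip : ∀ z₁ z₂ d, 0 ≤ d → 0 < z₁ → z₁ ≤ z₂ → P z₂ d - P z₁ d ≤ (z₂ - z₁) / z₁)
    {D μ τ : ℝ} (hD : 0 ≤ D) (hμ : μ ≤ 0) (hμτ : -μ < τ) (e : ℝ) {χ : ℝ} (hχ0 : 0 ≤ χ)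
    (hχ1 : |e| < τ → 1 ≤ χ) :
    P (e - μ) D - P (e + μ) D ≤ 2 * χ + 2 * (-μ) / (τ + μ) := by
  have hge : ∀ z, -1 ≤ P z D := fun z => by have := hle (-z) D hD; rw [hodd] at this; linarith
  have hK : 0 ≤ 2 * (-μ) / (τ + μ) := div_nonneg (by linarith) (by linarith)
  by_cases he : |e| < τ
  · have := hle (e - μ) D hD; have := hge (e + μ); have := hχ1 he; linarith
  · rw [not_lt] at he
    have key : ∀ e', τ ≤ e' → P (e' - μ) D - P (e' + μ) D ≤ 2 * (-μ) / (τ + μ) := by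
      intro e' he'
      have h1 := hlip (e' + μ) (e' - μ) D hD (by linarith) (by linarith)
      rw [show e' - μ - (e' + μ) = 2 * (-μ) by ring] at h1
      exact h1.trans (div_le_div_of_nonneg_left (by linarith) (by linarith) (by linarith))
    rcases le_or_gt 0 e with he0 | he0
    · rw [abs_of_nonneg he0] at he
      linarith [key e he]
    · rw [abs_of_neg he0] at he
      have h2 := key (-e) he
      rw [show -e - μ = -(e + μ) by ring, show -e + μ = -(e - μ) by ring, hodd, hodd] at h2
      linarith

/-! ### (D) The zone average for an abstract BdG function, and the stub -/

/-- **Abstract zone-average bound.** If `P : ℝ → ℝ → ℝ` is odd and `≤ 1` in its first argument, satisfies the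
one-sided Lipschitz bound `P z₂ d − P z₁ d ≤ (z₂ − z₁)/z₁` (`0 < z₁ ≤ z₂`, `d ≥ 0`), and the densities
`θ ↦ 1 − P(−2(cos θ₁ + cos θ₂) − μ', 8h²(cos θ₁ − cos θ₂)²)` are jointly continuous, then for
`μ ∈ [−1/50000, −1/100000]` the zone average of `1 − P(ξ, D)` is `≥ 19/20`. [folklore] -/
theorem fdh_density_ge_of_bdgFacts {P : ℝ → ℝ → ℝ} {h μ : ℝ}
    (hμ : μ ∈ Set.Icc (-(1 / 50000) : ℝ) (-(1 / 100000)))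
    (hodd : ∀ z d, P (-z) d = -P z d) (hle : ∀ z d, 0 ≤ d → P z d ≤ 1)
    (hlip : ∀ z₁ z₂ d, 0 ≤ d → 0 < z₁ → z₁ ≤ z₂ → P z₂ d - P z₁ d ≤ (z₂ - z₁) / z₁)
    (hcont : ∀ μ' : ℝ, Continuous (Function.uncurry fun θ₁ θ₂ : ℝ =>
      (1 - P (-2 * (Real.cos θ₁ + Real.cos θ₂) - μ') ((2 * Real.sqrt 2 * h * (Real.cos θ₁ - Real.cos θ₂)) ^ 2)))) :
    (19 / 20 : ℝ) ≤ (∫ θ₁ in (0 : ℝ)..2 * π, ∫ θ₂ in (0 : ℝ)..2 * π,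
      (1 - P (-2 * (Real.cos θ₁ + Real.cos θ₂) - μ) ((2 * Real.sqrt 2 * h * (Real.cos θ₁ - Real.cos θ₂)) ^ 2))) /
        (4 * π ^ 2) := by
  obtain ⟨hμ1, hμ2⟩ := hμ
  have hπ := Real.pi_pos
  have hK0 : 0 < 1 / 500 + μ := by linarith
  -- name the density `F` (kept opaque); its `(π,π)`-shift is `(θ₁, θ₂) ↦ F (θ₁ + π) (θ₂ + π)`
  obtain ⟨F, hF⟩ : ∃ F : ℝ → ℝ → ℝ, ∀ θ₁ θ₂, F θ₁ θ₂ =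
      (1 - P (-2 * (Real.cos θ₁ + Real.cos θ₂) - μ) ((2 * Real.sqrt 2 * h * (Real.cos θ₁ - Real.cos θ₂)) ^ 2)) :=
    ⟨_, fun _ _ => rfl⟩
  simp only [← hF]
  have hcF : Continuous (Function.uncurry F) := by
    have e : Function.uncurry F = Function.uncurry fun θ₁ θ₂ : ℝ =>
        (1 - P (-2 * (Real.cos θ₁ + Real.cos θ₂) - μ) ((2 * Real.sqrt 2 * h * (Real.cos θ₁ - Real.cos θ₂)) ^ 2)) :=
      funext fun p => hF p.1 p.2
    rw [e]; exact hcont μ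
  have hcG : Continuous (Function.uncurry fun θ₁ θ₂ : ℝ => F (θ₁ + π) (θ₂ + π)) :=
    hcF.comp ((continuous_fst.add continuous_const).prodMk (continuous_snd.add continuous_const))
  have hiF : ∀ θ₁, IntervalIntegrable (F θ₁) volume 0 (2 * π) := fun θ₁ =>
    (hcF.uncurry_left θ₁).intervalIntegrable _ _
  have hiG : ∀ θ₁, IntervalIntegrable (fun θ₂ => F (θ₁ + π) (θ₂ + π)) volume 0 (2 * π) := fun θ₁ =>
    (hcG.uncurry_left θ₁).intervalIntegrable _ _
  have hiχ : ∀ θ₁, IntervalIntegrable (fun θ₂ : ℝ => if |Real.cos θ₂ - -Real.cos θ₁| < 1 / 1000 then (1:ℝ) else 0)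
      volume 0 (2 * π) := fun θ₁ => fdh_intervalIntegrable_levelset (-Real.cos θ₁) (1 / 1000) 0 (2 * π)
  -- (A) the zone integral is invariant under the `(π,π)` shift
  have hshift : ∫ θ₁ in (0 : ℝ)..2 * π, ∫ θ₂ in (0 : ℝ)..2 * π, F (θ₁ + π) (θ₂ + π) =
      ∫ θ₁ in (0 : ℝ)..2 * π, ∫ θ₂ in (0 : ℝ)..2 * π, F θ₁ θ₂ :=
    fdh_double_integral_shift_pi F (fun x y => by rw [hF, hF, Real.cos_add_two_pi])
      (fun x y => by rw [hF, hF, Real.cos_add_two_pi])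
  -- (B) pointwise: `F + F∘shift = 2 − Γ ≥ (2 − K) − 2χ`, `K = 2m/(τ − m)`, `τ = 1/500`, `χ = 1{|cos θ₂ + cos θ₁| < τ/2}`
  have hpt : ∀ θ₁ θ₂, (2 - 2 * (-μ) / (1 / 500 + μ)) - 2 * (if |Real.cos θ₂ - -Real.cos θ₁| < 1 / 1000 then (1:ℝ) else 0) ≤
      F θ₁ θ₂ + F (θ₁ + π) (θ₂ + π) := by
    intro θ₁ θ₂
    have hD : 0 ≤ (2 * Real.sqrt 2 * h * (Real.cos θ₁ - Real.cos θ₂)) ^ 2 := sq_nonneg _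
    have hχ0 : (0:ℝ) ≤ (if |Real.cos θ₂ - -Real.cos θ₁| < 1 / 1000 then (1:ℝ) else 0) := by
      split_ifs <;> norm_num
    have hχ1 : |-2 * (Real.cos θ₁ + Real.cos θ₂)| < 1 / 500 →
        (1:ℝ) ≤ (if |Real.cos θ₂ - -Real.cos θ₁| < 1 / 1000 then (1:ℝ) else 0) := by
      intro he
      have hc : |Real.cos θ₂ - -Real.cos θ₁| < 1 / 1000 := by
        rw [abs_lt] at he ⊢
        constructor <;> linarith [he.1, he.2]
      rw [if_pos hc]
    have hΓ := fdh_gamma_le hodd hle hlip hD (show μ ≤ 0 by linarith) (show -μ < 1 / 500 by linarith)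
      (-2 * (Real.cos θ₁ + Real.cos θ₂)) hχ0 hχ1
    have e1 : P (-2 * (Real.cos (θ₁ + π) + Real.cos (θ₂ + π)) - μ)
          ((2 * Real.sqrt 2 * h * (Real.cos (θ₁ + π) - Real.cos (θ₂ + π))) ^ 2) =
        -P (-2 * (Real.cos θ₁ + Real.cos θ₂) + μ) ((2 * Real.sqrt 2 * h * (Real.cos θ₁ - Real.cos θ₂)) ^ 2) := by
      rw [← hodd, Real.cos_add_pi, Real.cos_add_pi]; congr 1 <;> ring
    rw [hF, hF]
    linarith [hΓ, e1]
  -- (C)+(D) the inner integral at fixed `θ₁`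
  have hinner : ∀ θ₁, 2 * π * (2 - 2 * (-μ) / (1 / 500 + μ)) - 2 * (2 * π * Real.sqrt (1 / 1000)) ≤
      ∫ θ₂ in (0 : ℝ)..2 * π, (F θ₁ θ₂ + F (θ₁ + π) (θ₂ + π)) := by
    intro θ₁
    have hmono : ∫ θ₂ in (0 : ℝ)..2 * π,
        ((2 - 2 * (-μ) / (1 / 500 + μ)) - 2 * (if |Real.cos θ₂ - -Real.cos θ₁| < 1 / 1000 then (1:ℝ) else 0)) ≤
        ∫ θ₂ in (0 : ℝ)..2 * π, (F θ₁ θ₂ + F (θ₁ + π) (θ₂ + π)) :=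
      intervalIntegral.integral_mono_on (by positivity) (intervalIntegrable_const.sub ((hiχ θ₁).const_mul 2))
        ((hiF θ₁).add (hiG θ₁)) fun θ₂ _ => hpt θ₁ θ₂
    rw [intervalIntegral.integral_sub intervalIntegrable_const ((hiχ θ₁).const_mul 2),
      intervalIntegral.integral_const, intervalIntegral.integral_const_mul] at hmono
    have hlev := fdh_integral_levelset_le (-Real.cos θ₁) (show (0:ℝ) < 1 / 1000 by norm_num)
    simp only [smul_eq_mul, sub_zero] at hmono
    linarith
  -- (D) the outer integral
  have hA : Continuous fun θ₁ => ∫ θ₂ in (0 : ℝ)..2 * π, F θ₁ θ₂ :=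
    intervalIntegral.continuous_parametric_intervalIntegral_of_continuous' hcF 0 (2 * π)
  have hB : Continuous fun θ₁ => ∫ θ₂ in (0 : ℝ)..2 * π, F (θ₁ + π) (θ₂ + π) :=
    intervalIntegral.continuous_parametric_intervalIntegral_of_continuous' hcG 0 (2 * π)
  have hsum : ∫ θ₁ in (0 : ℝ)..2 * π, ((∫ θ₂ in (0 : ℝ)..2 * π, F θ₁ θ₂) + ∫ θ₂ in (0 : ℝ)..2 * π, F (θ₁ + π) (θ₂ + π)) =
      (∫ θ₁ in (0 : ℝ)..2 * π, ∫ θ₂ in (0 : ℝ)..2 * π, F θ₁ θ₂) +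
        ∫ θ₁ in (0 : ℝ)..2 * π, ∫ θ₂ in (0 : ℝ)..2 * π, F (θ₁ + π) (θ₂ + π) :=
    intervalIntegral.integral_add (hA.intervalIntegrable _ _) (hB.intervalIntegrable _ _)
  have houter : ∫ θ₁ in (0 : ℝ)..2 * π, (2 * π * (2 - 2 * (-μ) / (1 / 500 + μ)) - 2 * (2 * π * Real.sqrt (1 / 1000))) ≤
      ∫ θ₁ in (0 : ℝ)..2 * π, ((∫ θ₂ in (0 : ℝ)..2 * π, F θ₁ θ₂) + ∫ θ₂ in (0 : ℝ)..2 * π, F (θ₁ + π) (θ₂ + π)) :=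
    intervalIntegral.integral_mono_on (by positivity) intervalIntegrable_const
      ((hA.intervalIntegrable _ _).add (hB.intervalIntegrable _ _)) fun θ₁ _ =>
      (hinner θ₁).trans_eq (intervalIntegral.integral_add (hiF θ₁) (hiG θ₁))
  rw [intervalIntegral.integral_const, hsum, hshift] at houter
  simp only [smul_eq_mul, sub_zero] at houter
  -- (E) arithmetic: `N ≥ 1 − √(1/1000) − (−μ)/(1/500 + μ) ≥ 1 − 0.0317 − 1/99 > 19/20`
  have hs : Real.sqrt (1 / 1000) ≤ 317 / 10000 := by
    rw [Real.sqrt_le_left (by norm_num)]; norm_num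
  have hKle : 2 * (-μ) / (1 / 500 + μ) ≤ 2 / 99 := by
    rw [div_le_iff₀ hK0]; linarith
  have hp : 0 < π ^ 2 := by positivity
  rw [le_div_iff₀ (by positivity)]
  nlinarith [houter, mul_le_mul_of_nonneg_left hs hp.le, mul_le_mul_of_nonneg_left hKle hp.le]

/-- **F3 `stub_freeDensityNearHalfFilling`** (registered stub of `stmt-HubbardSuperconductivity-15581`, line
`Sketch`): just below half filling (`μ ∈ [−1/50000, −1/100000]`), for `β ≥ 20000` and every pairing source `h`,
the Brillouin-zone average of the free `d`-wave BdG density `1 − (ξ/E) tanh(βE/2)` is at least `19/20`.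
[folklore: BdG mean-field density near half filling; `(π,π)` particle–hole symmetry] -/
theorem stub_freeDensityNearHalfFilling : ∀ (β h μ : ℝ), 20000 ≤ β → μ ∈ Set.Icc (-(1 / 50000) : ℝ) (-(1 / 100000)) → (19 / 20 : ℝ) ≤ ((∫ θ₁ in (0 : ℝ)..2 * π, ∫ θ₂ in (0 : ℝ)..2 * π, (1 - (if (-2 * (Real.cos θ₁ + Real.cos θ₂) - μ) ^ 2 + (2 * Real.sqrt 2 * h * (Real.cos θ₁ - Real.cos θ₂)) ^ 2 = 0 then (0:ℝ) else (-2 * (Real.cos θ₁ + Real.cos θ₂) - μ) / Real.sqrt ((-2 * (Real.cos θ₁ + Real.cos θ₂) - μ) ^ 2 + (2 * Real.sqrt 2 * h * (Real.cos θ₁ - Real.cos θ₂)) ^ 2) * Real.tanh (β * Real.sqrt ((-2 * (Real.cos θ₁ + Real.cos θ₂) - μ) ^ 2 + (2 * Real.sqrt 2 * h * (Real.cos θ₁ - Real.cos θ₂)) ^ 2) / 2)))) / (4 * π ^ 2)) := by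
  intro β h μ hβ hμ
  have hβ0 : 0 < β := by linarith
  exact fdh_density_ge_of_bdgFacts
    (P := fun z d => if z ^ 2 + d = 0 then (0:ℝ) else z / Real.sqrt (z ^ 2 + d) * Real.tanh (β * Real.sqrt (z ^ 2 + d) / 2))
    hμ (fdh_bdgPhi_neg β) (fun _ _ hd => fdh_bdgPhi_le_one β hd) (fun _ _ _ hd hz₁ hz => fdh_bdgPhi_sub_le hβ0 hd hz₁ hz)
    (fun μ' => cfl_continuous_bdgDensity β μ' h hβ0)

end Summit.HubbardSuperconductivity.HubbardSuperconductivity.Theorems.TwSeededEnsembleEquivalenceR.ColdFloorLine
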